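import Summits.CriticalPhenomena.PercolationContinuityZ3.Theorems.PercNearOneGluingNoHeavyRsw3NarrowHardCrossingCritical
import Summits.CriticalPhenomena.PercolationContinuityZ3.Theorems.PercNearOneGluingNoHeavyRsw3SlabBlocks
import Literature.Probability.Percolation.HalfSpaceBrickSeeds
import HarnessLib

/-!
# RSW3 lane (P2, gen 7): BEAMS — the block `{0..n} × {0..n} × {0..K}` is crossed the `n`-way at `p_c(ℤ³)` with
# probability `≥ 1/2` as soon as `K ≥ C n³`, uniformly in `n` (the one uniform statement the cube floor yields)

builds on p205010 (kernel theorem, internal audit signed; external expert review pending)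

Cell `prim-rsw3`, prover seat `prim-rsw3-p2` (gen 7), memo `run/shared/lean/prim/rsw3/P2-RSWLITE.md` §13.
Support file (`--supports stmt-CriticalPhenomena-4575`); no definitions, no named facts, no sorries.

A BEAM is a block `{0..n} × {0..n} × {0..K}` crossed in direction `0` (length `n`): one transverse side equals the
thickness (as for the cube), the other is long.  It sits between the cube (`K = n`, `CrossingLowerBound cubeShape 0`, OPEN)
and the easy slabs (`{0..n} × {0..kn}²`, `EasyCrossingLowerBound k`, proved).  `exists_half_le_real_boxCross_beam`: there is
`C` with

  `P_{p_c(ℤ³)}(boxCross ![n, n, K] 0) ≥ 1/2`   for all `n ≥ 1` and all `K ≥ C n³`.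

Proof: the beam contains `m = ⌊(K+1)/(n+1)⌋` vertex-disjoint translates `(0,0,t(n+1)) + {0..n}³` of the cube; their
crossing events (direction `0`, inside the translate) are determined by pairwise disjoint edge sets, hence independent
(`bondPercolation_real_biInter_eq_prod`), have the probability of the cube crossing (translation invariance,
`real_linked_image`) which is `≥ c/n²` for every side (`Rsw3.exists_le_real_boxCross_cubeShape`, gen 7), and each implies the
beam crossing; so `P(beam not crossed) ≤ (1 - c/n²)^m ≤ exp(-c m/n²) ≤ e^{-1} ≤ 1/2` once `m ≥ n²/c`, i.e. `K ≥ C n³`.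
HONEST SIZE: a trivial consequence of the cube floor and independence; the "beam exponent" `3 = 1 + 2` (one `n` for the
pitch of the sub-cubes, `n²` for the cube floor) would be `1` under the open cube bound (`Π_n ≥ c`), and a beam exponent
`< 1` would imply the cube bound (a crossing of a beam narrower than the cube is a cube crossing).  Recorded as the uniform
statement for the "weaker family" asked for in the lane brief; numerically (census-1, non-rigorous) `Π_n ≈ 0.29` flat, so
beams of length `≈ 3n` are already crossed w.p. `≥ 1/2`.

References: G. Grimmett, *Percolation* (1999), §1.3 (product measure), §11.7; H. Kesten, *Percolation Theory for
Mathematicians* (1982), §3.3 (block crossings, Comment (v)). [folklore]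
-/

noncomputable section

namespace Summit.CriticalPhenomena.PercolationContinuityZ3.Theorems

open MeasureTheory ProbabilityTheory Filter Topology
open Literature.Probability.Percolation Literature.Probability.LatticeModels
open Literature.Barriers.CriticalPhenomena

namespace Rsw3

open SurfaceTension Crossing

/-! ## The cube crossing as a linking event, and its translates -/

/-- **`P_{p}(boxCross (cubeShape n) 0) ≤ P_p(F₀ ↔ F₁ in {0..n}³)`** with `F₀ = {x₀ = 0}`, `F₁ = {x₀ = n}` the two faces
(as `linked` events; equality holds, only `≤` is used: an open path inside the block is a lattice path inside the block on
lattice configurations). [folklore] -/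
theorem real_boxCross_cubeShape_le_real_linked (p : unitInterval) (n : ℕ) :
    (bondPercolation (zdGraph 3) p).real (boxCross (cubeShape n) 0) ≤
      (bondPercolation (zdGraph 3) p).real
        (linked (↑(Finset.Icc (0 : Site 3) (cubeShape n)) : Set (Site 3))
          {x | x ∈ Finset.Icc (0 : Site 3) (cubeShape n) ∧ x 0 = 0}
          {x | x ∈ Finset.Icc (0 : Site 3) (cubeShape n) ∧ x 0 = n}) := by
  refine DCT16.real_mono_of_forall_subset_edgeSet (zdGraph 3) p fun ω hω h => ?_
  simp only [boxCross, Set.mem_setOf_eq] at h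
  obtain ⟨x, hx, y, hy, hxi, hyi, hxy⟩ := h
  have hr := Quant.reachable_within_of_pathIn hω (DCT16.pathIn_of_mem_openConnIn hxy)
  have hyn : y 0 = n := by rw [hyi]; simp [cubeShape]
  exact mem_linked_iff.2 ⟨x, ⟨hx, hxi⟩, y, ⟨hy, hyn⟩, mem_inConn_iff.2 hr⟩

/-- **Uniform crossing of beams at `p_c(ℤ³)`.**  There is `C ≥ 1` such that for every `n ≥ 1` and every `K ≥ C n³`
the block `{0..n} × {0..n} × {0..K}` is crossed inside itself in direction `0` with probability at least `1/2`:
`⌊(K+1)/(n+1)⌋ ≥ n²/c` disjoint translated cubes, each crossed independently with probability `≥ c/n²`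
(`exists_le_real_boxCross_cubeShape`), `(1 - c/n²)^m ≤ e^{-1} ≤ 1/2`.  A trivial but UNIFORM statement; the exponent
`3` is `1` under `CrossingLowerBound cubeShape 0` (open). [folklore] -/
theorem exists_half_le_real_boxCross_beam :
    ∃ C : ℕ, 1 ≤ C ∧ ∀ n : ℕ, 1 ≤ n → ∀ K : ℕ, C * n ^ 3 ≤ K →
      (1 : ℝ) / 2 ≤ (bondPercolation (zdGraph 3) (criticalProbI 3)).real (boxCross ![(n : ℤ), n, K] 0) := by
  classical
  obtain ⟨c₀, hc₀, hcube⟩ := exists_le_real_boxCross_cubeShape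
  -- work with `c = min c₀ 1 ≤ 1`
  set c : ℝ := min c₀ 1 with hc
  have hc0 : 0 < c := lt_min hc₀ one_pos
  have hc1 : c ≤ 1 := min_le_right _ _
  -- `M ≥ 1/c` sub-cubes per `n²`
  set M : ℕ := ⌈1 / c⌉₊ with hM
  have hM1 : 1 / c ≤ M := Nat.le_ceil _
  have hMpos : 1 ≤ M := by
    have h : (0 : ℝ) < M := lt_of_lt_of_le (by positivity) hM1
    have h' : 0 < M := by exact_mod_cast h
    omega
  refine ⟨2 * M, by omega, fun n hn K hK => ?_⟩
  set μ := bondPercolation (zdGraph 3) (criticalProbI 3) with hμ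
  -- the number of sub-cubes and their positions
  set m : ℕ := M * n ^ 2 with hm
  have hfit : m * (n + 1) ≤ K + 1 := by
    have h1 : m * (n + 1) ≤ 2 * M * n ^ 3 := by
      rw [hm]
      have : n + 1 ≤ 2 * n := by omega
      calc M * n ^ 2 * (n + 1) ≤ M * n ^ 2 * (2 * n) := Nat.mul_le_mul_left _ this
        _ = 2 * M * n ^ 3 := by ring
    omega
  -- the block, its faces, the translates
  set blk : Finset (Site 3) := Finset.Icc (0 : Site 3) (cubeShape n) with hblk
  set F₀ : Set (Site 3) := {x | x ∈ blk ∧ x 0 = 0} with hF₀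
  set F₁ : Set (Site 3) := {x | x ∈ blk ∧ x 0 = n} with hF₁
  set v : ℕ → Site 3 := fun t => ![0, 0, (t : ℤ) * (n + 1)] with hv
  set X : ℕ → Set (BondConfig (Site 3)) := fun t =>
    linked ((zdShiftIso (v t)) '' (↑blk : Set (Site 3))) ((zdShiftIso (v t)) '' F₀) ((zdShiftIso (v t)) '' F₁)
    with hX
  have hv_apply : ∀ (t : ℕ) (j : Fin 3), v t j = if j = 2 then (t : ℤ) * (n + 1) else 0 := by
    intro t j
    fin_cases j <;> simp [hv]
  -- (1) each translate has the probability of the cube crossing, `≥ c/n²`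
  have hPX : ∀ t, c / (n : ℝ) ^ 2 ≤ μ.real (X t) := by
    intro t
    have himg := real_linked_image (zdShiftIso (v t)) (criticalProbI 3) (↑blk : Set (Site 3)) F₀ F₁
    rw [← hμ] at himg
    have hX' : μ.real (X t) = μ.real (linked (↑blk : Set (Site 3)) F₀ F₁) := by rw [hX]; exact himg
    rw [hX']
    calc c / (n : ℝ) ^ 2 ≤ c₀ / (n : ℝ) ^ 2 := div_le_div_of_nonneg_right (min_le_left _ _) (by positivity)
      _ ≤ μ.real (boxCross (cubeShape n) 0) := hcube n hn
      _ ≤ _ := real_boxCross_cubeShape_le_real_linked (criticalProbI 3) n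
  -- (2) the translates lie in the beam and their crossings cross the beam
  set L : Site 3 := ![(n : ℤ), n, K] with hL
  have hL_apply : ∀ j : Fin 3, L j = if j = 2 then (K : ℤ) else n := by
    intro j; fin_cases j <;> simp [hL]
  have hcube_apply : ∀ j : Fin 3, cubeShape n j = n := by
    intro j; fin_cases j <;> simp [cubeShape]
  have hsub_blk : ∀ t, t < m → (zdShiftIso (v t)) '' (↑blk : Set (Site 3)) ⊆ ↑(Finset.Icc (0 : Site 3) L) := by
    intro t ht
    rintro _ ⟨x, hx, rfl⟩
    rw [Finset.mem_coe, hblk, Finset.mem_Icc] at hx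
    rw [Finset.mem_coe, Finset.mem_Icc, zdShiftIso_apply]
    have ht' : (t : ℤ) + 1 ≤ m := by exact_mod_cast ht
    have hfit' : (m : ℤ) * (n + 1) ≤ K + 1 := by exact_mod_cast hfit
    refine ⟨fun j => ?_, fun j => ?_⟩
    · have h := hx.1 j
      simp only [Pi.zero_apply] at h
      simp only [Pi.add_apply, Pi.zero_apply, hv_apply]
      split_ifs <;> nlinarith
    · have h1 := hx.2 j
      rw [hcube_apply] at h1
      simp only [Pi.add_apply, hv_apply, hL_apply]
      split_ifs with hj
      · nlinarith
      · simp; exact h1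
  have hXsub : ∀ t, t < m → X t ⊆ boxCross L 0 := by
    intro t ht ω hω
    have hω' : ω ∈ linked ((zdShiftIso (v t)) '' (↑blk : Set (Site 3))) ((zdShiftIso (v t)) '' F₀)
        ((zdShiftIso (v t)) '' F₁) := hω
    rw [mem_linked_iff] at hω'
    obtain ⟨a, ⟨a₀, ⟨ha₀, ha₀i⟩, rfl⟩, b, ⟨b₀, ⟨hb₀, hb₀i⟩, rfl⟩, hab⟩ := hω'
    have ha : (zdShiftIso (v t)) a₀ ∈ Finset.Icc (0 : Site 3) L :=
      hsub_blk t ht ⟨a₀, Finset.mem_coe.2 ha₀, rfl⟩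
    have hb : (zdShiftIso (v t)) b₀ ∈ Finset.Icc (0 : Site 3) L :=
      hsub_blk t ht ⟨b₀, Finset.mem_coe.2 hb₀, rfl⟩
    have hconn : ω ∈ inConn (↑(Finset.Icc (0 : Site 3) L) : Set (Site 3)) ((zdShiftIso (v t)) a₀)
        ((zdShiftIso (v t)) b₀) := inConn_mono (hsub_blk t ht) _ _ hab
    simp only [boxCross, Set.mem_setOf_eq]
    refine ⟨_, ha, _, hb, ?_, ?_, ?_⟩
    · rw [zdShiftIso_apply, Pi.add_apply, ha₀i, hv_apply]; simp
    · rw [zdShiftIso_apply, Pi.add_apply, hb₀i, hv_apply, hL_apply]; simp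
    · rw [openConnIn_eq_openConnVia (Finset.mem_coe.2 ha)]
      exact openConnVia_mono_graph (Quant.withinGraph_le_withinGraph_top _) _ _ hconn
  -- (3) independence of the complements
  have hdet : ∀ t ∈ Finset.range m, DeterminedBy (X t)ᶜ
      (↑(edgesIn (zdGraph 3) (blk.image (· + v t))) : Set (Sym2 (Site 3))) := by
    intro t _
    have himg : (zdShiftIso (v t)) '' (↑blk : Set (Site 3)) = ↑(blk.image (· + v t)) := by
      rw [Finset.coe_image]; rfl
    rw [hX]
    simp only [himg]
    exact (determinedBy_linked_edgesIn _ _ _).compl'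
  have hmeas : ∀ t ∈ Finset.range m, MeasurableSet (X t)ᶜ := fun t _ => (measurableSet_linked _ _ _).compl
  have hdisj : (↑(Finset.range m) : Set ℕ).PairwiseDisjoint
      fun t => (↑(edgesIn (zdGraph 3) (blk.image (· + v t))) : Set (Sym2 (Site 3))) := by
    intro t _ t' _ htt'
    refine disjoint_edgesIn_of_disjoint (Finset.disjoint_left.2 fun x hx hx' => htt' ?_)
    rw [Finset.mem_image] at hx hx'
    obtain ⟨y, hy, rfl⟩ := hx
    obtain ⟨y', hy', hyy'⟩ := hx'
    rw [hblk, Finset.mem_Icc] at hy hy'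
    have h2 := congrFun hyy' 2
    simp only [Pi.add_apply, hv_apply] at h2
    simp at h2
    have hy2 := hy.2 2; have hy2' := hy'.2 2; have hy0 := hy.1 2; have hy0' := hy'.1 2
    rw [hcube_apply] at hy2 hy2'
    simp only [Pi.zero_apply] at hy0 hy0'
    -- `y' 2 + t'(n+1) = y 2 + t(n+1)` with `0 ≤ y 2, y' 2 ≤ n` forces `t = t'`
    have hn1 : (0 : ℤ) < n + 1 := by positivity
    have key : ((t : ℤ) - t') * (n + 1) = y' 2 - y 2 := by linear_combination (-1 : ℤ) * h2
    have hle : ((t : ℤ) - t') * (n + 1) ≤ n := by rw [key]; linarith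
    have hge : -(n : ℤ) ≤ ((t : ℤ) - t') * (n + 1) := by rw [key]; linarith
    rcases lt_trichotomy ((t : ℤ) - t') 0 with hlt | heq | hgt
    · exfalso
      have : ((t : ℤ) - t') * (n + 1) ≤ (-1) * (n + 1) :=
        mul_le_mul_of_nonneg_right (by omega) hn1.le
      linarith
    · exact_mod_cast (sub_eq_zero.1 heq)
    · exfalso
      have : 1 * ((n : ℤ) + 1) ≤ ((t : ℤ) - t') * (n + 1) :=
        mul_le_mul_of_nonneg_right (by omega) hn1.le
      linarith
  have hprod : μ.real (⋂ t ∈ Finset.range m, (X t)ᶜ) = ∏ t ∈ Finset.range m, μ.real (X t)ᶜ :=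
    bondPercolation_real_biInter_eq_prod (zdGraph 3) (criticalProbI 3) (Finset.range m) (fun t => (X t)ᶜ) _
      hdet hmeas hdisj
  -- (4) the product is small
  have hn0 : (0 : ℝ) < n := by exact_mod_cast hn
  have hcn : c / (n : ℝ) ^ 2 ≤ 1 := by
    rw [div_le_one (by positivity)]
    exact hc1.trans (one_le_pow₀ (by exact_mod_cast hn))
  have hfac : ∀ t ∈ Finset.range m, μ.real (X t)ᶜ ≤ 1 - c / (n : ℝ) ^ 2 := by
    intro t _
    rw [probReal_compl_eq_one_sub (measurableSet_linked _ _ _)]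
    linarith [hPX t]
  have hsmall : μ.real (⋂ t ∈ Finset.range m, (X t)ᶜ) ≤ 1 / 2 := by
    rw [hprod]
    calc ∏ t ∈ Finset.range m, μ.real (X t)ᶜ ≤ ∏ _t ∈ Finset.range m, (1 - c / (n : ℝ) ^ 2) :=
          Finset.prod_le_prod (fun t _ => measureReal_nonneg) hfac
      _ = (1 - c / (n : ℝ) ^ 2) ^ m := by rw [Finset.prod_const, Finset.card_range]
      _ ≤ (Real.exp (-(c / (n : ℝ) ^ 2))) ^ m := by
          apply pow_le_pow_left₀ (by linarith)
          have := Real.add_one_le_exp (-(c / (n : ℝ) ^ 2))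
          linarith
      _ = Real.exp (-(c / (n : ℝ) ^ 2 * m)) := by rw [← Real.exp_nat_mul]; ring_nf
      _ ≤ Real.exp (-1) := by
          apply Real.exp_le_exp.2
          have hm' : (m : ℝ) = M * (n : ℝ) ^ 2 := by rw [hm]; push_cast; ring
          have hcM : 1 ≤ c * M := by
            have := mul_le_mul_of_nonneg_left hM1 hc0.le
            rwa [mul_one_div_cancel hc0.ne'] at this
          rw [hm']
          have : c / (n : ℝ) ^ 2 * (M * (n : ℝ) ^ 2) = c * M := by field_simp
          rw [this]; linarith
      _ ≤ 1 / 2 := by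
          have h2 : (2 : ℝ) ≤ Real.exp 1 := by have := Real.add_one_le_exp (1 : ℝ); linarith
          rw [Real.exp_neg]
          rw [inv_eq_one_div]
          exact one_div_le_one_div_of_le (by norm_num) h2
  -- (5) complement: the beam is crossed unless every sub-cube fails
  have hcover : (Set.univ : Set (BondConfig (Site 3))) ⊆ boxCross L 0 ∪ ⋂ t ∈ Finset.range m, (X t)ᶜ := by
    intro ω _
    by_cases h : ∃ t ∈ Finset.range m, ω ∈ X t
    · obtain ⟨t, ht, hωt⟩ := h
      exact Or.inl (hXsub t (Finset.mem_range.1 ht) hωt)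
    · push Not at h
      exact Or.inr (Set.mem_iInter₂.2 fun t ht => h t ht)
  have h1 : (1 : ℝ) ≤ μ.real (boxCross L 0) + μ.real (⋂ t ∈ Finset.range m, (X t)ᶜ) := by
    calc (1 : ℝ) = μ.real Set.univ := (probReal_univ).symm
      _ ≤ μ.real (boxCross L 0 ∪ ⋂ t ∈ Finset.range m, (X t)ᶜ) := measureReal_mono hcover
      _ ≤ _ := measureReal_union_le _ _
  rw [hL] at h1
  linarith

end Rsw3

end Summit.CriticalPhenomena.PercolationContinuityZ3.Theorems

end
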